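import Literature.AnabelianGeometry.AbsoluteAnabelian.LocalResidueMapQmodZ
import Literature.AnabelianGeometry.AbsoluteAnabelian.AbsAnabProp121viiBrauerTorsionProofs
import Literature.NumberTheory.GaloisRepresentations.KummerTwoTorsion
import Literature.NumberTheory.GaloisRepresentations.CorNaturality
import HarnessLib

/-!
# `H²(G_K, μ_{ℚ/ℤ}) ⥲ H²(G_K, K̄ˣ)` (Kummer, colimit level) and the local invariant map `Br(K) ⥲ ℚ/ℤ`

[AbsAnab] (S. Mochizuki, 2004) Prop. 1.2.1 (vii) proof p. 11 (N1): «the natural isomorphism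
`H²(G_K, μ_{ℚ/ℤ}(K̄)) ⥲ H²(G_K, K̄ˣ)`»; [AbsTopIII] Prop. 3.2 (i) p. 71 l.22–26: «the natural isomorphism
[of Brauer groups] `H²(G, μ_{ℚ/ℤ}(M_TM)) ⥲ H²(G, M^gp_TM)`» (plan row P32.i.L01, slot
`Prop32iChain.brauerKummer`).  The tree PROVES the level statement (abc-iut-w5-d198
`kummerTwoOntoTorsion_holds`: `H²(μ_n) ↪ H²(K̄ˣ)` with image the `n`-torsion) and that `H²(G_K, K̄ˣ)` is
torsion (`exists_nsmul_two_eq_zero`, Serre CG I §2.4).  Over the colimit object `H2MuQZ K` of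
`LocalResidueMapQmodZ.lean` this file assembles (constructions + proofs, no new `Prop`):

* `Prop121vii.brauerKummerQZ : H2MuQZ K →+ H²(G_K, K̄ˣ)` (colimit of the Kummer maps) and
  **`brauerKummerQZEquiv : H2MuQZ K ≃+ H²(G_K, K̄ˣ)`** — row P32.i.L01 / N1 at the `μ_{ℚ/ℤ}` level;
* **`Prop121vii.brauerInvariantEquiv K : H²(G_K, K̄ˣ) ≃+ ℚ/ℤ`** — THE LOCAL INVARIANT MAP `inv_K : Br(K) ⥲ ℚ/ℤ`
  as one kernel isomorphism (`brauerKummerQZEquiv⁻¹` followed by `invariantQZEquiv`), with its value on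
  the Kummer image of a level-`n` class (`brauerInvariantEquiv_kummer` : `= inv_n/n`).

`ℚ/ℤ = AddCircle (1 : ℚ)`.  HONEST FRAMING: classical local class field theory (Serre, *Local Fields*
XIII §3) as proved in the tree; nothing here bears on [IUTchIII] Cor. 3.12; no side taken.
-/

noncomputable section

universe u

namespace Literature.AnabelianGeometry.AbsoluteAnabelian

open CategoryTheory Field Function
open Literature.NumberTheory.GaloisRepresentations
open Literature.NumberTheory.GaloisRepresentations.DiscreteGaloisModule

namespace Prop121vii

variable (K : Type u) [Field K]

/-- `(μ_n ⊆ μ_N) ≫ (μ_N ↪ K̄ˣ) = (μ_n ↪ K̄ˣ)` as morphisms of discrete `Γ_K`-modules.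
[cite: MochizukiAbsAnab2004, Prop 1.2.1 (vii) p.11] -/
theorem muInclHom_comp_kummerι {n N : ℕ} (h : n ∣ N) :
    muInclHom K h ≫ kummerι K N = kummerι K n :=
  TopRep.hom_ext (ContIntertwiningMap.ext (ContinuousLinearMap.ext fun _ => rfl))

/-- Compatibility of the level Kummer maps on `H²` with `H²(μ_n ⊆ μ_N)`.
[cite: MochizukiAbsAnab2004, Prop 1.2.1 (vii) p.11] -/
theorem cohomologyMap_kummerι_comp_muInclHom {n N : ℕ} (h : n ∣ N) (x : galoisCohomology (mu K n) 2) :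
    cohomologyMap (kummerι K N) 2 (cohomologyMap (muInclHom K h) 2 x) = cohomologyMap (kummerι K n) 2 x := by
  haveI : CompactSpace (absoluteGaloisGroup K) := absoluteGaloisGroup_compactSpace K
  rw [← cohomologyMap_comp_apply, muInclHom_comp_kummerι]

/-- **The Kummer map at the `μ_{ℚ/ℤ}` level**, `H²(G_K, μ_{ℚ/ℤ}) → H²(G_K, K̄ˣ)`: the colimit of the
`H²(μ_n ↪ K̄ˣ)`. [cite: MochizukiAbsAnab2004, Prop 1.2.1 (vii) p.11] -/
def brauerKummerQZ : H2MuQZ K →+ galoisCohomology (units K) 2 :=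
  AddCommGroup.DirectLimit.lift (fun m : DivLevel => galoisCohomology (mu K (m.val : ℕ)) 2) (H2MuSystem K)
    (galoisCohomology (units K) 2)
    (fun m => (cohomologyMap (kummerι K (m.val : ℕ)) 2).hom.toLinearMap.toAddMonoidHom)
    (fun _ _ hij x => cohomologyMap_kummerι_comp_muInclHom K (DivLevel.le_iff.1 hij) x)

variable {K}

/-- Value on a level-`n` class. [cite: MochizukiAbsAnab2004, Prop 1.2.1 (vii) p.11] -/
theorem brauerKummerQZ_of (n : ℕ+) (x : galoisCohomology (mu K (n : ℕ)) 2) :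
    brauerKummerQZ K (H2MuQZ.of n x) = cohomologyMap (kummerι K (n : ℕ)) 2 x :=
  AddCommGroup.DirectLimit.lift_of (G := fun m : DivLevel => galoisCohomology (mu K (m.val : ℕ)) 2)
    (f := H2MuSystem K) _ _ _ (DivLevel.ofPNat n) x

variable [ValuativeRel K] [TopologicalSpace K] [IsNonarchimedeanLocalField K] [CharZero K]

/-- `brauerKummerQZ` is injective (each level Kummer map is, `kummerTwoOntoTorsion_holds`).
[cite: MochizukiAbsAnab2004, Prop 1.2.1 (vii) p.11] -/
theorem brauerKummerQZ_injective : Injective (brauerKummerQZ K) := by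
  refine (injective_iff_map_eq_zero _).2 fun z hz => ?_
  obtain ⟨n, x, rfl⟩ := H2MuQZ.exists_of z
  rw [brauerKummerQZ_of] at hz
  have h0 : cohomologyMap (kummerι K (n : ℕ)) 2 (0 : galoisCohomology (mu K (n : ℕ)) 2) = 0 :=
    (cohomologyMap (kummerι K (n : ℕ)) 2).hom.map_zero
  have hx : x = 0 := (kummerTwoOntoTorsion_holds K (n : ℕ)).1 (hz.trans h0.symm)
  rw [hx, map_zero]

/-- `brauerKummerQZ` is surjective: `H²(G_K, K̄ˣ)` is torsion (`exists_nsmul_two_eq_zero`) and the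
`n`-torsion is the image of level `n` (`kummerTwoOntoTorsion_holds`). [cite: MochizukiAbsAnab2004, Prop 1.2.1 (vii) p.11] -/
theorem brauerKummerQZ_surjective : Surjective (brauerKummerQZ K) := by
  intro z
  haveI : CompactSpace (absoluteGaloisGroup K) := absoluteGaloisGroup_compactSpace K
  obtain ⟨n, hn, hnz⟩ := exists_nsmul_two_eq_zero (units K) z
  haveI : NeZero n := ⟨hn.ne'⟩
  obtain ⟨x, hx⟩ := (kummerTwoOntoTorsion_holds K n).2 z (by rw [natCast_zsmul]; exact hnz)
  exact ⟨H2MuQZ.of ⟨n, hn⟩ x, by rw [brauerKummerQZ_of]; exact hx⟩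

variable (K)

/-- **«`H²(G_K, μ_{ℚ/ℤ}(K̄)) ⥲ H²(G_K, K̄ˣ)`»** ([AbsAnab] Prop 1.2.1 (vii) N1; [AbsTopIII] Prop 3.2 (i)
«the natural isomorphism [of Brauer groups] `H²(G, μ_{ℚ/ℤ}(M_TM)) ⥲ H²(G, M^gp_TM)`», plan row P32.i.L01),
at the `μ_{ℚ/ℤ}` level, CONSTRUCTED. [cite: MochizukiAbsAnab2004, Prop 1.2.1 (vii) p.11] -/
def brauerKummerQZEquiv : H2MuQZ K ≃+ galoisCohomology (units K) 2 :=
  AddEquiv.ofBijective (brauerKummerQZ K) ⟨brauerKummerQZ_injective, brauerKummerQZ_surjective⟩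

variable {K}

/-- Value of the Kummer isomorphism on a level-`n` class. [cite: MochizukiAbsAnab2004, Prop 1.2.1 (vii) p.11] -/
theorem brauerKummerQZEquiv_of (n : ℕ+) (x : galoisCohomology (mu K (n : ℕ)) 2) :
    brauerKummerQZEquiv K (H2MuQZ.of n x) = cohomologyMap (kummerι K (n : ℕ)) 2 x :=
  brauerKummerQZ_of n x

variable (K)

/-- **The local invariant map `inv_K : Br(K) = H²(G_K, K̄ˣ) ⥲ ℚ/ℤ` as ONE isomorphism** (Serre,
*Local Fields* XIII §3; [AbsAnab] Prop 1.2.1 (vii) «the residue map … of local class field theory»):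
`(brauerKummerQZEquiv K)⁻¹` followed by the `μ_{ℚ/ℤ}`-level residue isomorphism `invariantQZEquiv K`.
CONSTRUCTED. [cite: MochizukiAbsAnab2004, Prop 1.2.1 (vii) p.11] -/
def brauerInvariantEquiv : galoisCohomology (units K) 2 ≃+ AddCircle (1 : ℚ) :=
  (brauerKummerQZEquiv K).symm.trans (invariantQZEquiv K)

variable {K}

/-- **Normalisation of `inv_K`**: on the Kummer image of a level-`n` class `x ∈ H²(G_K, μ_n)` the invariant
is `inv_n(x)/n ∈ (1/n)ℤ/ℤ`, `inv_n` THE residue map of level `n` (`invLevel`).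
[cite: MochizukiAbsAnab2004, Prop 1.2.1 (vii) p.11] -/
theorem brauerInvariantEquiv_kummer (n : ℕ+) (x : galoisCohomology (mu K (n : ℕ)) 2) :
    brauerInvariantEquiv K (cohomologyMap (kummerι K (n : ℕ)) 2 x) =
      (((((invLevel K (n : ℕ) x).val : ℚ)) / (n : ℕ) : ℚ) : AddCircle (1 : ℚ)) := by
  rw [brauerInvariantEquiv, AddEquiv.trans_apply, ← brauerKummerQZEquiv_of, AddEquiv.symm_apply_apply,
    invariantQZEquiv_of]

/-- Every Brauer class is the Kummer image of a class of some finite level (surjectivity, restated for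
consumers). [cite: MochizukiAbsAnab2004, Prop 1.2.1 (vii) p.11] -/
theorem exists_cohomologyMap_kummerι_eq (z : galoisCohomology (units K) 2) :
    ∃ (n : ℕ+) (x : galoisCohomology (mu K (n : ℕ)) 2), cohomologyMap (kummerι K (n : ℕ)) 2 x = z := by
  obtain ⟨w, rfl⟩ := brauerKummerQZ_surjective (K := K) z
  obtain ⟨n, x, rfl⟩ := H2MuQZ.exists_of w
  exact ⟨n, x, (brauerKummerQZ_of n x).symm⟩

end Prop121vii

end Literature.AnabelianGeometry.AbsoluteAnabelian

end
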